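import Summits.BirchSwinnertonDyer.BirchSwinnertonDyer.Theorems.GenusKolyvaginAtTwoGenusPrimitiveSupplyAtTwoGenusComponentsTower
import Summits.BirchSwinnertonDyer.BirchSwinnertonDyer.Theorems.KolyvaginRoadThreeLevelData
import Literature.NumberTheory.EllipticCurves.RingClassGalOverCyclicProofs

/-!
# Route `GenusKolyvaginAtTwo`, crux stmt-BirchSwinnertonDyer-24947 `MultiGenusPrimitivityAtTwo` (U, open kernel of
# stmt-BirchSwinnertonDyer-22136): the UNCONDITIONAL DEPTH LAW for genus-character Heegner components, and the DEPTH-2 REDUCTION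
# of the certificate to ONE genus Heegner point

Lead prover seat bsd-line-gk2-p1 (g5). Frame of `…GenusComponents` / `…GenusComponentsTower` (ns `…Theorems.GenusKoly`):
`n` square-free of Kolyvagin primes at `2` (`r = #{ℓ ∣ n}`), a Kolyvagin–Heegner datum `d` of conductor `n`, genus radicals
`θ_ℓ = √ℓ* ∈ K[n]`, `G` an enumeration of `𝒢_n = Gal(K[n]/K)`, the genus-character components
`Y_M^{(n)} = Σ_{g ∈ G} χ_M(g)·g·y(n)` (`M ⊆ {ℓ ∣ n}`), the multi-genus trace `Z_n` with `2^r·Z_n = Σ_M Y_M^{(n)}`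
(`heegner_two_pow_smul_multiGenusTrace_eq_sum_genusComponents`) and the tower relation `Y_M^{(n)} = A(n/m)·(Y_M^{(m)})′`,
`A(t) = ∏_{ℓ∣t} a_ℓ` (`heegner_genusComponent_eq_prod_frobeniusTrace_smul_map`).

What this file adds (theorems about points; no BSD, no Gross–Zagier, no hypothesis on `M₀`):
* §1 `squarefree_split`: bookkeeping `n = (∏M)·(∏(P∖M))` for `M ⊆ P = {ℓ ∣ n}`.
* §2 `heegner_exists_pow_smul_eq_genusComponent_of_level_of_pow_dvd`: the (R1)-chain input of `…GenusComponentsTower` at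
  DEPTH `e`: if `2^e ∣ a_ℓ` for every `ℓ ∣ n/m` and `Y_M^{(m)} ∈ 2^c E(K[m])` then `Y_M^{(n)} ∈ 2^{c + e·#{ℓ ∣ n/m}} E(K[n])`.
* §3 **THE DEPTH LAW** `heegner_exists_two_pow_card_smul_eq_topGenusComponent`: for EVERY square-free `n` of Kolyvagin
  primes at `2`, every datum, radicals and enumeration, the top component `Y_{P}^{(n)}` (`P = {ℓ ∣ n}`, the genus Heegner point of
  the ring class character `χ_n ↔ K(√n*)`, i.e. the Gross–Zagier datum of the genus twist `E^{(n*)}/K`) lies in `2^r E(K[n])`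
  UNCONDITIONALLY (strong induction on `r`: the lower components are `2^r`-divisible by the induction hypothesis at their own
  levels — data there exist by `nonempty_kolyvaginHeegnerData_of_grossCM` with both Gross-§3 inputs PROVED — and the even
  `a_ℓ`; then `Y_P = 2^r Z_n − Σ_{M ⊊ P} Y_M`). This is CHECK 3 of the cell's U-LEDGER (`ord₂ m_m ≥ #{ℓ ∣ m}`) at every level, as a
  theorem: the «reduced genus points» `W_M := Y_M/2^{#M}` exist in `E(K[m])`. Consequently every component satisfies
  `Y_M^{(n)} ∈ 2^{r + (e−1)·#{ℓ ∣ n/m}} E(K[n])` at depth `e` (`heegner_exists_pow_smul_eq_genusComponent_of_depth`).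
* §4 **THE DEPTH-2 REDUCTION** `heegner_exists_two_zsmul_eq_derivedPoint_iff_topGenusComponent_of_depth_two`: if every `ℓ ∣ n`
  has `4 ∣ a_ℓ` (Kolyvagin index `M(ℓ) ≥ 2`), then every non-top component is `2^{r+1}`-deep UNCONDITIONALLY, so by the
  (R2)-mechanism `P(n) ∈ 2E(K[n]) ⟺ Y_P^{(n)} ∈ 2^{r+1} E(K[n])`: at depth-2 levels the crux's certificate IS the statement
  «the reduced genus Heegner point `W_n = Y_n/2^r` of the twist `E^{(n*)}` is not `2`-divisible in `E(K[n])`» — one point, no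
  gluing between eigen-lattices, no lower-level or `M₀ ≥ 1` hypothesis. Prime level: `P(ℓ) ∈ 2E(K[ℓ]) ⟺ Y_ℓ ∈ 4E(K[ℓ])` at a
  Kolyvagin prime with `4 ∣ a_ℓ` (`…ExactnessCriterion` had this under `M₀ ≥ 1`).
* §5 Crux currency: `heegner_multiGenusCertificate_iff_topGenusComponent_of_depth_two` (the certificate clause of
  `MultiGenusPrimitivityAtTwo` at a depth-2 level ⟺ the top component is not `2^{r+1}`-deep) and
  `multiGenusPrimitivityAtTwo_of_reducedGenusIndex` (crux 24947 BY NAME from «some depth-2 level has a `2`-primitive reduced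
  genus Heegner point», pointwise in `(W, K, Dt, β, ι)`, hence valid for the ∀K-, `DEF = 1`- and ∃K-typings alike).
READING (for the pen / -data; BSD-side via U-LEDGER (♣), not used here): at a depth-2 level only the top `κ` can be odd, so U at
such levels ⟺ «`ord₂[E^{(n*)}(K) : ℤY_n] = r` exactly» = EXACT-INDEX₂ of the genus pair `(E^{(n*)}, E^{(n*d_K)})` — W. Zhang's theorem
at `p = 2` for that pair; the SUPPLY of such a level with a 2-Selmer-minimal pair is the Mazur–Rubin half. Helper
(`--supports stmt-BirchSwinnertonDyer-24947`); the crux stays OPEN; BSD is not proved by any of this.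
-/

set_option linter.dupNamespace false -- tree convention: `Summit.BirchSwinnertonDyer.BirchSwinnertonDyer.Theorems` (summit = sub-problem)

noncomputable section

open scoped Classical

namespace Summit.BirchSwinnertonDyer.BirchSwinnertonDyer.Theorems.GenusKoly

open Finset NumberField WeierstrassCurve Literature.NumberTheory.EllipticCurves
  Literature.NumberTheory.EllipticCurves.ModularForms

/-! ## §1 Bookkeeping: splitting a square-free level along a set of its primes -/

section Bookkeeping

/-- **`n = (∏M)·(∏(P∖M))` for `M ⊆ P = {ℓ ∣ n}`, `n` square-free**, with the prime factors and square-freeness of both parts.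
[folklore] -/
theorem squarefree_split {n : ℕ} (hn : Squarefree n) {M : Finset ℕ} (hM : M ⊆ n.primeFactors) :
    (∏ ℓ ∈ M, ℓ) * (∏ ℓ ∈ n.primeFactors \ M, ℓ) = n ∧ (∏ ℓ ∈ M, ℓ).primeFactors = M ∧
      (∏ ℓ ∈ n.primeFactors \ M, ℓ).primeFactors = n.primeFactors \ M ∧ Squarefree (∏ ℓ ∈ M, ℓ) ∧
      Squarefree (∏ ℓ ∈ n.primeFactors \ M, ℓ) := by
  have hP : ∀ p ∈ n.primeFactors, p.Prime := fun p hp ↦ Nat.prime_of_mem_primeFactors hp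
  have hmul : (∏ ℓ ∈ M, ℓ) * (∏ ℓ ∈ n.primeFactors \ M, ℓ) = n := by
    rw [mul_comm, Finset.prod_sdiff hM, Nat.prod_primeFactors_of_squarefree hn]
  refine ⟨hmul, Nat.primeFactors_prod (fun p hp ↦ hP p (hM hp)),
    Nat.primeFactors_prod (fun p hp ↦ hP p (Finset.sdiff_subset hp)), ?_, ?_⟩
  · exact Squarefree.squarefree_of_dvd (Dvd.intro _ hmul) hn
  · exact Squarefree.squarefree_of_dvd (Dvd.intro_left _ hmul) hn

end Bookkeeping

section Heegner

variable {W : WeierstrassCurve ℚ} [NeZero (W.conductorNorm ℤ)] {K : Type} [Field K] [NumberField K]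
  {Dt : ModularParametrizationData W (W.conductorNorm ℤ)} {β : ℤ} {ι : K →+* ℂ}

/-! ## §2 The tower input at depth `e`: `Y_M^{(n)} ∈ 2^{c + e·#{ℓ∣t}} E(K[n])` -/

/-- **Components deep at their own level stay deep up the tower, with DEPTH `e` per prime.** For `W` globally minimal,
`K` imaginary quadratic with `d_K < −4` and the Heegner hypothesis, `n = m·t` square-free with every prime factor inert in `K`
and prime to `N_E`, a datum `d` of conductor `n`, a point `y ∈ E(K[m])` over `x(m)`, radicals `θ` (level `n`), `θ′` (level
`m`) for the primes of `M`, enumerations `G`, `Gm` of `𝒢_n`, `𝒢_m`: if `2^e ∣ a_ℓ` for every `ℓ ∣ t` and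
`Y_M^{(m)} ∈ 2^c E(K[m])`, then `Y_M^{(n)} ∈ 2^{c + e·#{ℓ ∣ t}} E(K[n])` (`Y_M^{(n)} = (∏_{ℓ∣t} a_ℓ)·(Y_M^{(m)})′`). At `e = 1` this is
`heegner_exists_pow_smul_eq_genusComponent_of_level`. [cite: GrossLMS1991, §3 (3.5), Prop. 3.7 (1), §4 (4.1)] -/
theorem heegner_exists_pow_smul_eq_genusComponent_of_level_of_pow_dvd [W.IsElliptic] [W.IsGloballyMinimal]
    (hK : IsImaginaryQuadratic K) (hD : NumberField.discr K < -4) (hH : SatisfiesHeegnerHypothesis (W.conductorNorm ℤ) K)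
    {n : ℕ} (hn : Squarefree n) (hinert : ∀ q ∈ n.primeFactors, (Ideal.span {(q : 𝓞 K)}).IsPrime)
    (hN : ∀ q ∈ n.primeFactors, ¬ q ∣ W.conductorNorm ℤ) (d : KolyvaginHeegnerData Dt β ι n)
    {m t : ℕ} (hmt : m * t = n) {e : ℕ} (hpow : ∀ ℓ ∈ t.primeFactors, ((2 : ℤ) ^ e) ∣ W.frobeniusTrace ℓ)
    {y : (W.baseChange (ringClassField K ι m)).toAffine.Point}
    (hy : WeierstrassCurve.Affine.Point.map (W' := W) (ringClassField K ι m).subtype.toRatAlgHom y =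
      heegnerPointComplexOfConductor Dt (NumberField.discr K) β m)
    (hle : ringClassField K ι m ≤ ringClassField K ι n)
    {θ : ℕ → ringClassField K ι n} {θ' : ℕ → ringClassField K ι m} {M : Finset ℕ}
    (hθ : ∀ ℓ ∈ M, θ ℓ ^ 2 = algebraMap ℚ (ringClassField K ι n) ((-1 : ℚ) ^ (ℓ / 2) * ℓ))
    (hθ' : ∀ ℓ ∈ M, θ' ℓ ^ 2 = algebraMap ℚ (ringClassField K ι m) ((-1 : ℚ) ^ (ℓ / 2) * ℓ))
    (G : Finset (ringClassField K ι n ≃ₐ[ℚ] ringClassField K ι n)) (hG : ∀ g, g ∈ G ↔ g ∈ ringClassGal ι n)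
    (Gm : Finset (ringClassField K ι m ≃ₐ[ℚ] ringClassField K ι m)) (hGm : ∀ s, s ∈ Gm ↔ s ∈ ringClassGal ι m)
    {c : ℕ} (hdeep : ∃ R : (W.baseChange (ringClassField K ι m)).toAffine.Point, ((2 : ℤ) ^ c) • R =
      ∑ s ∈ Gm, (∏ ℓ ∈ M, (if s (θ' ℓ) = θ' ℓ then (1 : ℤ) else -1)) • pointGalHom W (ringClassField K ι m) s y) :
    ∃ Q : (W.baseChange (ringClassField K ι n)).toAffine.Point, ((2 : ℤ) ^ (c + e * t.primeFactors.card)) • Q =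
      ∑ g ∈ G, (∏ ℓ ∈ M, (if g (θ ℓ) = θ ℓ then (1 : ℤ) else -1)) • pointGalHom W (ringClassField K ι n) g d.y := by
  -- `∏_{ℓ∣t} a_ℓ = 2^{e·#} · A′`
  have hA : ∃ A' : ℤ, (∏ ℓ ∈ t.primeFactors, W.frobeniusTrace ℓ) = (2 : ℤ) ^ (e * t.primeFactors.card) * A' := by
    choose! b hb using hpow
    refine ⟨∏ ℓ ∈ t.primeFactors, b ℓ, ?_⟩
    rw [Finset.prod_congr rfl (fun ℓ hℓ ↦ hb ℓ hℓ), Finset.prod_mul_distrib, Finset.prod_const, ← pow_mul]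
  obtain ⟨A', hA'⟩ := hA
  obtain ⟨R, hR⟩ := hdeep
  refine ⟨A' • WeierstrassCurve.Affine.Point.map (W' := W) (Subfield.inclusion hle).toRatAlgHom R, ?_⟩
  rw [heegner_genusComponent_eq_prod_frobeniusTrace_smul_map hK hD hH hn hinert hN d hmt hy hle hθ hθ' G hG Gm hGm, ← hR, map_zsmul,
    hA', smul_smul, smul_smul, pow_add]
  congr 1
  ring

/-! ## §3 THE DEPTH LAW: `Y_{top}^{(n)} ∈ 2^r E(K[n])` unconditionally -/

/-- **THE DEPTH LAW (unconditional).** For `W` globally minimal elliptic, `K` imaginary quadratic with `d_K < −4` and the Heegner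
hypothesis, EVERY square-free `n` of Kolyvagin primes at `2`, every Kolyvagin–Heegner datum `d` of conductor `n`, radicals
`θ_ℓ² = ℓ*` (`ℓ ∣ n`) in `K[n]` and enumeration `G` of `Gal(K[n]/K)`: the top genus-character component
`Y_n := Σ_{g ∈ G} χ_{{ℓ∣n}}(g)·g·y(n)` — the genus Heegner point of the ring class character `χ_n ↔ K(√n*)` — is `2^r`-divisible in
`E(K[n])`, `r = #{ℓ ∣ n}`. Proof: strong induction on `r` through `2^r·Z_n = Σ_{M ⊆ {ℓ∣n}} Y_M^{(n)}`; for `M ⊊ {ℓ ∣ n}` the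
component is `A(n/m)·(Y_M^{(m)})′` with `Y_M^{(m)} ∈ 2^{#M}E(K[m])` (induction at level `m = ∏M`, where data exist:
`nonempty_kolyvaginHeegnerData_of_grossCM` with both CM inputs proved) and `2^{r−#M} ∣ A(n/m)` (even `a_ℓ`). No BSD, no Gross–Zagier,
no `2`-torsion hypothesis. [cite: GrossLMS1991, §3 (3.5), Prop. 3.7 (1), §4 (4.1)] [cite: McCallumLMS1991, §5] -/
theorem heegner_exists_two_pow_card_smul_eq_topGenusComponent [W.IsElliptic] [W.IsGloballyMinimal]
    (hK : IsImaginaryQuadratic K) (hD : NumberField.discr K < -4) (hH : SatisfiesHeegnerHypothesis (W.conductorNorm ℤ) K)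
    {n : ℕ} (hn : Squarefree n) (hKoly : ∀ ℓ ∈ n.primeFactors, Zhang2014.IsKolyvaginPrime (W.conductorNorm ℤ) W K 2 ℓ)
    (d : KolyvaginHeegnerData Dt β ι n) {θ : ℕ → ringClassField K ι n}
    (hθ : ∀ ℓ ∈ n.primeFactors, θ ℓ ^ 2 = algebraMap ℚ (ringClassField K ι n) ((-1 : ℚ) ^ (ℓ / 2) * ℓ))
    (G : Finset (ringClassField K ι n ≃ₐ[ℚ] ringClassField K ι n)) (hG : ∀ g, g ∈ G ↔ g ∈ ringClassGal ι n) :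
    ∃ R : (W.baseChange (ringClassField K ι n)).toAffine.Point, ((2 : ℤ) ^ n.primeFactors.card) • R =
      ∑ g ∈ G, (∏ ℓ ∈ n.primeFactors, (if g (θ ℓ) = θ ℓ then (1 : ℤ) else -1)) •
        pointGalHom W (ringClassField K ι n) g d.y := by
  haveI : Fact (Nat.Prime 2) := ⟨Nat.prime_two⟩
  -- strong induction on the number of prime factors, over all levels / data / radicals / enumerations
  suffices key : ∀ (r : ℕ) {n : ℕ}, n.primeFactors.card = r → Squarefree n →
      (∀ ℓ ∈ n.primeFactors, Zhang2014.IsKolyvaginPrime (W.conductorNorm ℤ) W K 2 ℓ) →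
      ∀ (d : KolyvaginHeegnerData Dt β ι n) (θ : ℕ → ringClassField K ι n),
        (∀ ℓ ∈ n.primeFactors, θ ℓ ^ 2 = algebraMap ℚ (ringClassField K ι n) ((-1 : ℚ) ^ (ℓ / 2) * ℓ)) →
        ∀ (G : Finset (ringClassField K ι n ≃ₐ[ℚ] ringClassField K ι n)), (∀ g, g ∈ G ↔ g ∈ ringClassGal ι n) →
          ∃ R : (W.baseChange (ringClassField K ι n)).toAffine.Point, ((2 : ℤ) ^ n.primeFactors.card) • R =
            ∑ g ∈ G, (∏ ℓ ∈ n.primeFactors, (if g (θ ℓ) = θ ℓ then (1 : ℤ) else -1)) •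
              pointGalHom W (ringClassField K ι n) g d.y from
    key _ rfl hn hKoly d θ hθ G hG
  intro r
  induction r using Nat.strong_induction_on with
  | _ r ih =>
    intro n hr hn hKoly d θ hθ G hG
    have hn0 : n ≠ 0 := hn.ne_zero
    have hinert : ∀ q ∈ n.primeFactors, (Ideal.span {(q : 𝓞 K)}).IsPrime := fun q hq ↦ (hKoly q hq).2.2.2.2.1
    have hN : ∀ q ∈ n.primeFactors, ¬ q ∣ W.conductorNorm ℤ := fun q hq ↦ (hKoly q hq).2.1
    set P := n.primeFactors with hP_def
    -- every PROPER sub-component is `2^r`-divisible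
    have hlow : ∀ M ∈ P.powerset.erase P, ∃ Q : (W.baseChange (ringClassField K ι n)).toAffine.Point,
        ((2 : ℤ) ^ r) • Q = ∑ g ∈ G, (∏ ℓ ∈ M, (if g (θ ℓ) = θ ℓ then (1 : ℤ) else -1)) •
          pointGalHom W (ringClassField K ι n) g d.y := by
      intro M hM'
      have hMne : M ≠ P := Finset.ne_of_mem_erase hM'
      have hM : M ⊆ P := Finset.mem_powerset.mp (Finset.mem_of_mem_erase hM')
      obtain ⟨hmt, hmP, htP, hmsq, -⟩ := squarefree_split hn hM
      set m := ∏ ℓ ∈ M, ℓ with hm_def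
      set t := ∏ ℓ ∈ P \ M, ℓ with ht_def
      have hm0 : m ≠ 0 := hmsq.ne_zero
      have hmn : m ∣ n := Dvd.intro _ hmt
      have hKolym : ∀ ℓ ∈ m.primeFactors, Zhang2014.IsKolyvaginPrime (W.conductorNorm ℤ) W K 2 ℓ := fun ℓ hℓ ↦
        hKoly ℓ (hM (hmP ▸ hℓ))
      have hinertm : ∀ q ∈ m.primeFactors, (Ideal.span {(q : 𝓞 K)}).IsPrime := fun q hq ↦ (hKolym q hq).2.2.2.2.1
      -- cardinalities: `#M < r`, `#M + #(P \ M) = r`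
      have hcardM : M.card < r := by
        rw [← hr]
        exact Finset.card_lt_card (Finset.ssubset_iff_subset_ne.mpr ⟨hM, hMne⟩)
      have hcard : M.card + t.primeFactors.card = r := by
        rw [htP, Finset.card_sdiff_of_subset hM, ← hr, Nat.add_sub_cancel' (Finset.card_le_card hM)]
      -- data at level `m` (CM theory, both inputs proved), radicals and an enumeration there
      obtain ⟨dm⟩ : Nonempty (KolyvaginHeegnerData Dt β ι m) :=
        nonempty_kolyvaginHeegnerData_of_grossCM
          (phi_heegnerPointOfConductor_mem_range_map_ringClassField_holds (W.conductorNorm ℤ) W K)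
          exists_generator_ringClassGalOver_holds hK hH Dt β ι d.dvd_sq_sub hmsq hinertm
      obtain ⟨θ', hθ'⟩ := heegner_exists_multiGenusRadicals hK hmsq hKolym dm
      obtain ⟨Gm, hGm⟩ := heegner_exists_finset_ringClassGal (ι := ι) hK hm0
      -- induction hypothesis at level `m`: `Y_M^{(m)} ∈ 2^{#M} E(K[m])`
      obtain ⟨Rm, hRm⟩ := ih M.card hcardM (by rw [hmP]) hmsq hKolym dm θ' hθ' Gm hGm
      rw [hmP] at hRm
      -- lift along `K[m] ⊆ K[n]` with one factor `2` per prime of `t = n/m`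
      have hle : ringClassField K ι m ≤ ringClassField K ι n := ringClassField_mono hK ι hmn hn0
      have heven : ∀ ℓ ∈ t.primeFactors, ((2 : ℤ) ^ 1) ∣ W.frobeniusTrace ℓ := fun ℓ hℓ ↦ by
        rw [pow_one]
        have hℓP : ℓ ∈ P := Finset.sdiff_subset (htP ▸ hℓ)
        exact_mod_cast (hKoly ℓ hℓP).dvd.2
      obtain ⟨Q, hQ⟩ := heegner_exists_pow_smul_eq_genusComponent_of_level_of_pow_dvd hK hD hH hn hinert hN d hmt heven
        dm.map_y hle (fun ℓ hℓ ↦ hθ ℓ (hM hℓ)) (fun ℓ hℓ ↦ hθ' ℓ (hmP ▸ hℓ)) G hG Gm hGm ⟨Rm, hRm⟩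
      refine ⟨Q, ?_⟩
      rwa [one_mul, hcard] at hQ
    -- assemble: `Y_P = 2^r Z − Σ_{M ⊊ P} Y_M`
    choose! Q hQ using hlow
    have hdec := heegner_two_pow_smul_multiGenusTrace_eq_sum_genusComponents d θ G
    rw [← hP_def, hr, ← Finset.add_sum_erase _ _ (Finset.mem_powerset_self P)] at hdec
    refine ⟨∑ g ∈ G.filter (fun g ↦ ∀ ℓ ∈ P, g (θ ℓ) = θ ℓ), pointGalHom W (ringClassField K ι n) g d.y -
      ∑ M ∈ P.powerset.erase P, Q M, ?_⟩
    rw [hr, smul_sub, hdec, Finset.smul_sum, Finset.sum_congr rfl (fun M hM ↦ hQ M hM), add_sub_cancel_right]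

/-- **Every component at depth `e`**: `Y_M^{(n)} ∈ 2^{#M + e·(r − #M)} E(K[n])` for `M ⊆ {ℓ ∣ n}` whenever `2^e ∣ a_ℓ` for the primes
of `n` outside `M` (depth law at level `∏M` lifted by §2). With `e = 1`: every component is `2^r`-divisible.
[cite: GrossLMS1991, §3 (3.5), Prop. 3.7 (1), §4 (4.1)] -/
theorem heegner_exists_pow_smul_eq_genusComponent_of_depth [W.IsElliptic] [W.IsGloballyMinimal]
    (hK : IsImaginaryQuadratic K) (hD : NumberField.discr K < -4) (hH : SatisfiesHeegnerHypothesis (W.conductorNorm ℤ) K)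
    {n : ℕ} (hn : Squarefree n) (hKoly : ∀ ℓ ∈ n.primeFactors, Zhang2014.IsKolyvaginPrime (W.conductorNorm ℤ) W K 2 ℓ)
    (d : KolyvaginHeegnerData Dt β ι n) {θ : ℕ → ringClassField K ι n}
    (hθ : ∀ ℓ ∈ n.primeFactors, θ ℓ ^ 2 = algebraMap ℚ (ringClassField K ι n) ((-1 : ℚ) ^ (ℓ / 2) * ℓ))
    (G : Finset (ringClassField K ι n ≃ₐ[ℚ] ringClassField K ι n)) (hG : ∀ g, g ∈ G ↔ g ∈ ringClassGal ι n)
    {M : Finset ℕ} (hM : M ⊆ n.primeFactors) {e : ℕ}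
    (hpow : ∀ ℓ ∈ n.primeFactors \ M, ((2 : ℤ) ^ e) ∣ W.frobeniusTrace ℓ) :
    ∃ Q : (W.baseChange (ringClassField K ι n)).toAffine.Point,
      ((2 : ℤ) ^ (M.card + e * (n.primeFactors.card - M.card))) • Q =
        ∑ g ∈ G, (∏ ℓ ∈ M, (if g (θ ℓ) = θ ℓ then (1 : ℤ) else -1)) • pointGalHom W (ringClassField K ι n) g d.y := by
  have hn0 : n ≠ 0 := hn.ne_zero
  have hinert : ∀ q ∈ n.primeFactors, (Ideal.span {(q : 𝓞 K)}).IsPrime := fun q hq ↦ (hKoly q hq).2.2.2.2.1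
  have hN : ∀ q ∈ n.primeFactors, ¬ q ∣ W.conductorNorm ℤ := fun q hq ↦ (hKoly q hq).2.1
  obtain ⟨hmt, hmP, htP, hmsq, -⟩ := squarefree_split hn hM
  set m := ∏ ℓ ∈ M, ℓ with hm_def
  set t := ∏ ℓ ∈ n.primeFactors \ M, ℓ with ht_def
  have hm0 : m ≠ 0 := hmsq.ne_zero
  have hmn : m ∣ n := Dvd.intro _ hmt
  have hKolym : ∀ ℓ ∈ m.primeFactors, Zhang2014.IsKolyvaginPrime (W.conductorNorm ℤ) W K 2 ℓ := fun ℓ hℓ ↦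
    hKoly ℓ (hM (hmP ▸ hℓ))
  have hinertm : ∀ q ∈ m.primeFactors, (Ideal.span {(q : 𝓞 K)}).IsPrime := fun q hq ↦ (hKolym q hq).2.2.2.2.1
  obtain ⟨dm⟩ : Nonempty (KolyvaginHeegnerData Dt β ι m) :=
    nonempty_kolyvaginHeegnerData_of_grossCM
      (phi_heegnerPointOfConductor_mem_range_map_ringClassField_holds (W.conductorNorm ℤ) W K)
      exists_generator_ringClassGalOver_holds hK hH Dt β ι d.dvd_sq_sub hmsq hinertm
  obtain ⟨θ', hθ'⟩ := heegner_exists_multiGenusRadicals hK hmsq hKolym dm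
  obtain ⟨Gm, hGm⟩ := heegner_exists_finset_ringClassGal (ι := ι) hK hm0
  obtain ⟨Rm, hRm⟩ := heegner_exists_two_pow_card_smul_eq_topGenusComponent hK hD hH hmsq hKolym dm hθ' Gm hGm
  rw [hmP] at hRm
  have hle : ringClassField K ι m ≤ ringClassField K ι n := ringClassField_mono hK ι hmn hn0
  have hpow' : ∀ ℓ ∈ t.primeFactors, ((2 : ℤ) ^ e) ∣ W.frobeniusTrace ℓ := fun ℓ hℓ ↦ hpow ℓ (htP ▸ hℓ)
  obtain ⟨Q, hQ⟩ := heegner_exists_pow_smul_eq_genusComponent_of_level_of_pow_dvd hK hD hH hn hinert hN d hmt hpow'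
    dm.map_y hle (fun ℓ hℓ ↦ hθ ℓ (hM hℓ)) (fun ℓ hℓ ↦ hθ' ℓ (hmP ▸ hℓ)) G hG Gm hGm ⟨Rm, hRm⟩
  refine ⟨Q, ?_⟩
  rwa [htP, Finset.card_sdiff_of_subset hM] at hQ

/-! ## §4 THE DEPTH-2 REDUCTION: at levels with `4 ∣ a_ℓ` the certificate is the top component alone -/

/-- **At a level all of whose primes have `4 ∣ a_ℓ`, `P(n) ∈ 2E(K[n]) ⟺ Y_n ∈ 2^{r+1} E(K[n])`**, `Y_n` the top genus-character
component. For `W` globally minimal with `ρ̄_{E,2}` onto, `K` imaginary quadratic with odd `d_K ≠ −3` and the Heegner hypothesis,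
`n` square-free of Kolyvagin primes at `2` with `4 ∣ a_ℓ` for every `ℓ ∣ n` (Kolyvagin index `M(ℓ) ≥ 2`), a datum `d` of conductor
`n`, radicals and an enumeration: every component `Y_M`, `M ⊊ {ℓ∣n}`, lies in `2^{#M + 2(r − #M)} ⊆ 2^{r+1} E(K[n])` (§3), so the
(R2)-mechanism `heegner_exists_two_zsmul_eq_derivedPoint_iff_genusComponent` applies with the top index as the exceptional one.
No `M₀ ≥ 1`, no lower-level, no BSD hypothesis. [cite: GrossLMS1991, §3 (3.5), Prop. 3.7 (1), §4 (4.1), Lemma 4.3]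
[cite: McCallumLMS1991, §5] -/
theorem heegner_exists_two_zsmul_eq_derivedPoint_iff_topGenusComponent_of_depth_two [W.IsElliptic] [W.IsGloballyMinimal]
    (hK : IsImaginaryQuadratic K) (hodd : Odd (NumberField.discr K)) (h3 : NumberField.discr K ≠ -3)
    (hH : SatisfiesHeegnerHypothesis (W.conductorNorm ℤ) K) (hsurj : W.HasSurjectiveModNGaloisRep ((2 : ℤ) ^ 1))
    {n : ℕ} (hn : Squarefree n) (hKoly : ∀ ℓ ∈ n.primeFactors, Zhang2014.IsKolyvaginPrime (W.conductorNorm ℤ) W K 2 ℓ)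
    (hfour : ∀ ℓ ∈ n.primeFactors, (4 : ℤ) ∣ W.frobeniusTrace ℓ)
    (d : KolyvaginHeegnerData Dt β ι n) {θ : ℕ → ringClassField K ι n}
    (hθ : ∀ ℓ ∈ n.primeFactors, θ ℓ ^ 2 = algebraMap ℚ (ringClassField K ι n) ((-1 : ℚ) ^ (ℓ / 2) * ℓ))
    (G : Finset (ringClassField K ι n ≃ₐ[ℚ] ringClassField K ι n)) (hG : ∀ g, g ∈ G ↔ g ∈ ringClassGal ι n) :
    (∃ Q : (W.baseChange (ringClassField K ι n)).toAffine.Point, (2 : ℤ) • Q = d.derivedPoint) ↔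
      ∃ Q : (W.baseChange (ringClassField K ι n)).toAffine.Point, ((2 : ℤ) ^ (n.primeFactors.card + 1)) • Q =
        ∑ g ∈ G, (∏ ℓ ∈ n.primeFactors, (if g (θ ℓ) = θ ℓ then (1 : ℤ) else -1)) •
          pointGalHom W (ringClassField K ι n) g d.y := by
  have hD : NumberField.discr K < -4 := discr_lt_neg_four_of_odd hK hodd h3
  refine heegner_exists_two_zsmul_eq_derivedPoint_iff_genusComponent hK hodd h3 hH hsurj hn hKoly d hθ G hG
    (Finset.mem_powerset_self _) ?_
  intro M hM' hne
  have hM : M ⊆ n.primeFactors := Finset.mem_powerset.mp hM'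
  have hpow : ∀ ℓ ∈ n.primeFactors \ M, ((2 : ℤ) ^ 2) ∣ W.frobeniusTrace ℓ := fun ℓ hℓ ↦ by
    norm_num
    exact hfour ℓ (Finset.sdiff_subset hℓ)
  obtain ⟨Q, hQ⟩ := heegner_exists_pow_smul_eq_genusComponent_of_depth hK hD hH hn hKoly d hθ G hG hM hpow
  -- `#M + 2(r − #M) = (r + 1) + (r − #M − 1)` since `#M < r`
  have hlt : M.card < n.primeFactors.card := Finset.card_lt_card (Finset.ssubset_iff_subset_ne.mpr ⟨hM, hne⟩)
  obtain ⟨k, hk⟩ : ∃ k, M.card + 2 * (n.primeFactors.card - M.card) = (n.primeFactors.card + 1) + k :=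
    ⟨n.primeFactors.card - M.card - 1, by omega⟩
  refine ⟨((2 : ℤ) ^ k) • Q, ?_⟩
  rw [smul_smul, ← pow_add, ← hk, hQ]

/-- **Prime level, depth 2: `P(ℓ) ∈ 2E(K[ℓ]) ⟺ Y_ℓ ∈ 4E(K[ℓ])`** at a Kolyvagin prime at `2` with `4 ∣ a_ℓ` — the genus trace
`Y_ℓ = Σ_{g} χ_ℓ(g)·g·y(ℓ)` (the Heegner datum of the genus pair `(E^{(ℓ*)}, E^{(ℓ*d_K)})`) is EXACTLY ONCE `2`-divisible iff the
level certifies (`Y_ℓ ∈ 2E(K[ℓ])` always, §3 at `r = 1`); no hypothesis on `M₀` (compare `…ExactnessCriterion`, which assumes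
`M₀ ≥ 1`). [cite: GrossLMS1991, §3 (3.5), Prop. 3.7 (1), §4 (4.1), Lemma 4.3] -/
theorem heegner_exists_two_zsmul_eq_derivedPoint_iff_four_dvd_genusTrace_of_depth_two [W.IsElliptic] [W.IsGloballyMinimal]
    (hK : IsImaginaryQuadratic K) (hodd : Odd (NumberField.discr K)) (h3 : NumberField.discr K ≠ -3)
    (hH : SatisfiesHeegnerHypothesis (W.conductorNorm ℤ) K) (hsurj : W.HasSurjectiveModNGaloisRep ((2 : ℤ) ^ 1))
    {ℓ : ℕ} (hℓ : ℓ.Prime) (hKoly : Zhang2014.IsKolyvaginPrime (W.conductorNorm ℤ) W K 2 ℓ)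
    (hfour : (4 : ℤ) ∣ W.frobeniusTrace ℓ)
    (d : KolyvaginHeegnerData Dt β ι ℓ) {θ : ringClassField K ι ℓ}
    (hθ : θ ^ 2 = algebraMap ℚ (ringClassField K ι ℓ) ((-1 : ℚ) ^ (ℓ / 2) * ℓ))
    (G : Finset (ringClassField K ι ℓ ≃ₐ[ℚ] ringClassField K ι ℓ)) (hG : ∀ g, g ∈ G ↔ g ∈ ringClassGal ι ℓ) :
    (∃ Q : (W.baseChange (ringClassField K ι ℓ)).toAffine.Point, (2 : ℤ) • Q = d.derivedPoint) ↔
      ∃ Q : (W.baseChange (ringClassField K ι ℓ)).toAffine.Point, (4 : ℤ) • Q =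
        ∑ g ∈ G, (if g θ = θ then (1 : ℤ) else -1) • pointGalHom W (ringClassField K ι ℓ) g d.y := by
  have hP : ℓ.primeFactors = {ℓ} := hℓ.primeFactors
  have h := heegner_exists_two_zsmul_eq_derivedPoint_iff_topGenusComponent_of_depth_two hK hodd h3 hH hsurj
    hℓ.squarefree (θ := fun _ ↦ θ) (by rw [hP]; simpa using hKoly) (by rw [hP]; simpa using hfour) d
    (by rw [hP]; simpa using hθ) G hG
  rw [hP] at h
  simpa using h

/-! ## §5 Crux currency: the certificate clause of `MultiGenusPrimitivityAtTwo` at depth-2 levels -/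

/-- **The crux's certificate at a depth-2 level ⟺ the top component is not `2^{r+1}`-deep.** Same frame, with `T` ANY finite
set enumerating the radical stabiliser `{g ∈ 𝒢_n : gθ_ℓ = θ_ℓ ∀ℓ}` (as in the conclusion of `MultiGenusPrimitivityAtTwo`):
`¬ ∃ Q, 2Q = Σ_{g∈T} g·y(n)` iff `¬ ∃ Q, 2^{r+1}Q = Y_n`. [cite: GrossLMS1991, §3 (3.5), Prop. 3.7 (1), §4 (4.1), Lemma 4.3] -/
theorem heegner_multiGenusCertificate_iff_topGenusComponent_of_depth_two [W.IsElliptic] [W.IsGloballyMinimal]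
    (hK : IsImaginaryQuadratic K) (hodd : Odd (NumberField.discr K)) (h3 : NumberField.discr K ≠ -3)
    (hH : SatisfiesHeegnerHypothesis (W.conductorNorm ℤ) K) (hsurj : W.HasSurjectiveModNGaloisRep ((2 : ℤ) ^ 1))
    {n : ℕ} (hn : Squarefree n) (hKoly : ∀ ℓ ∈ n.primeFactors, Zhang2014.IsKolyvaginPrime (W.conductorNorm ℤ) W K 2 ℓ)
    (hfour : ∀ ℓ ∈ n.primeFactors, (4 : ℤ) ∣ W.frobeniusTrace ℓ)
    (d : KolyvaginHeegnerData Dt β ι n) {θ : ℕ → ringClassField K ι n}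
    (hθ : ∀ ℓ ∈ n.primeFactors, θ ℓ ^ 2 = algebraMap ℚ (ringClassField K ι n) ((-1 : ℚ) ^ (ℓ / 2) * ℓ))
    (G : Finset (ringClassField K ι n ≃ₐ[ℚ] ringClassField K ι n)) (hG : ∀ g, g ∈ G ↔ g ∈ ringClassGal ι n)
    (T : Finset (ringClassField K ι n ≃ₐ[ℚ] ringClassField K ι n))
    (hT : ∀ g, g ∈ T ↔ g ∈ ringClassGal ι n ∧ ∀ ℓ ∈ n.primeFactors, g (θ ℓ) = θ ℓ) :
    (¬ ∃ Q : (W.baseChange (ringClassField K ι n)).toAffine.Point, (2 : ℤ) • Q =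
        ∑ g ∈ T, pointGalHom W (ringClassField K ι n) g d.y) ↔
      ¬ ∃ Q : (W.baseChange (ringClassField K ι n)).toAffine.Point, ((2 : ℤ) ^ (n.primeFactors.card + 1)) • Q =
        ∑ g ∈ G, (∏ ℓ ∈ n.primeFactors, (if g (θ ℓ) = θ ℓ then (1 : ℤ) else -1)) •
          pointGalHom W (ringClassField K ι n) g d.y := by
  have hD : NumberField.discr K < -4 := discr_lt_neg_four_of_odd hK hodd h3
  rw [← heegner_exists_two_zsmul_eq_derivedPoint_iff_multiGenusTrace hK hD hH hn hKoly d hθ T hT,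
    heegner_exists_two_zsmul_eq_derivedPoint_iff_topGenusComponent_of_depth_two hK hodd h3 hH hsurj hn hKoly hfour d hθ G hG]

/-- **Pointwise supply of the crux's witness from a reduced genus point.** Same standing frame `(W, K, Dt, β, ι)`: if SOME
square-free `n` of Kolyvagin primes at `2` with `4 ∣ a_ℓ` (`ℓ ∣ n`), some datum `d` of conductor `n`, radicals and an enumeration
have a top genus component `Y_n ∉ 2^{r+1}E(K[n])` (i.e. the reduced genus Heegner point `W_n = Y_n/2^r` of §3 is `2`-primitive),
then the witness clause of `MultiGenusPrimitivityAtTwo` / `GenusPrimitiveSupplyAtTwo` holds at that frame: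
`∃ n d θ T, … ∧ ¬ ∃ Q, 2Q = Σ_{g∈T} g·y(n)`. Valid for every typing of the child (∀K, `DEF = 1`, ∃K), being pointwise.
[cite: GrossLMS1991, §3 (3.5), Prop. 3.7 (1), §4 (4.1), Lemma 4.3] -/
theorem heegner_exists_multiGenusCertificate_of_reducedGenusIndex [W.IsElliptic] [W.IsGloballyMinimal]
    (hK : IsImaginaryQuadratic K) (hodd : Odd (NumberField.discr K)) (h3 : NumberField.discr K ≠ -3)
    (hH : SatisfiesHeegnerHypothesis (W.conductorNorm ℤ) K) (hsurj : W.HasSurjectiveModNGaloisRep ((2 : ℤ) ^ 1))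
    (hred : ∃ (n : ℕ) (d : KolyvaginHeegnerData Dt β ι n) (θ : ℕ → ringClassField K ι n)
      (G : Finset (ringClassField K ι n ≃ₐ[ℚ] ringClassField K ι n)),
      Squarefree n ∧ (∀ ℓ ∈ n.primeFactors, Zhang2014.IsKolyvaginPrime (W.conductorNorm ℤ) W K 2 ℓ) ∧
      (∀ ℓ ∈ n.primeFactors, (4 : ℤ) ∣ W.frobeniusTrace ℓ) ∧
      (∀ ℓ ∈ n.primeFactors, θ ℓ ^ 2 = algebraMap ℚ (ringClassField K ι n) ((-1 : ℚ) ^ (ℓ / 2) * ℓ)) ∧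
      (∀ g, g ∈ G ↔ g ∈ ringClassGal ι n) ∧
      ¬ ∃ Q : (W.baseChange (ringClassField K ι n)).toAffine.Point, ((2 : ℤ) ^ (n.primeFactors.card + 1)) • Q =
        ∑ g ∈ G, (∏ ℓ ∈ n.primeFactors, (if g (θ ℓ) = θ ℓ then (1 : ℤ) else -1)) •
          pointGalHom W (ringClassField K ι n) g d.y) :
    ∃ (n : ℕ) (d : KolyvaginHeegnerData Dt β ι n) (θ : ℕ → ringClassField K ι n)
      (T : Finset (ringClassField K ι n ≃ₐ[ℚ] ringClassField K ι n)),
      Squarefree n ∧ (∀ ℓ ∈ n.primeFactors, Zhang2014.IsKolyvaginPrime (W.conductorNorm ℤ) W K 2 ℓ) ∧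
      (∀ ℓ ∈ n.primeFactors, θ ℓ ^ 2 = algebraMap ℚ (ringClassField K ι n) ((-1 : ℚ) ^ (ℓ / 2) * ℓ)) ∧
      (∀ g, g ∈ T ↔ g ∈ ringClassGal ι n ∧ ∀ ℓ ∈ n.primeFactors, g (θ ℓ) = θ ℓ) ∧
      ¬ ∃ Q : (W.baseChange (ringClassField K ι n)).toAffine.Point, (2 : ℤ) • Q =
        ∑ g ∈ T, pointGalHom W (ringClassField K ι n) g d.y := by
  obtain ⟨n, d, θ, G, hn, hKoly, hfour, hθ, hG, hnot⟩ := hred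
  refine ⟨n, d, θ, G.filter (fun g ↦ ∀ ℓ ∈ n.primeFactors, g (θ ℓ) = θ ℓ), hn, hKoly, hθ, fun g ↦ by
    rw [Finset.mem_filter, hG], ?_⟩
  rwa [heegner_multiGenusCertificate_iff_topGenusComponent_of_depth_two hK hodd h3 hH hsurj hn hKoly hfour d hθ G hG _
    (fun g ↦ by rw [Finset.mem_filter, hG])]

end Heegner

end Summit.BirchSwinnertonDyer.BirchSwinnertonDyer.Theorems.GenusKoly

end
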